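import Mathlib
import Summits.NavierStokesRegularity.NavierStokesRegularity.Theses.QuarterLogPincer
import HarnessLib

/-!
# `QuarterLogPincer.SuperlogTypeIRateGlue` — the glue of the gen-1 split of `SuperlogTypeIRate`
# (item stmt-NavierStokesRegularity-23633; pure logic)

**Statement.** `SubexpQuantESS → QuantBridge → SuperlogTypeIRate`, where
`QuantBridge := SubexpQuantESS → SuperlogTypeIRate`: modus ponens.

The analytic content of the split is `QuantBridge` (item stmt-NavierStokesRegularity-23632, PROVED:
`Theorems.QuantBridge.quantBridge_proof`); the open child is `SubexpQuantESS`
(stmt-NavierStokesRegularity-23631). HONEST FRAMING: pure logic between the route's own statements;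
nothing about Navier–Stokes regularity is proved here.
-/

noncomputable section

set_option linter.dupNamespace false

namespace Summit.NavierStokesRegularity.NavierStokesRegularity.Theorems

/-- **Item stmt-NavierStokesRegularity-23633** (`QuarterLogPincer.SuperlogTypeIRateGlue`):
`SubexpQuantESS → QuantBridge → SuperlogTypeIRate` is modus ponens (`QuantBridge` unfolds to
`SubexpQuantESS → SuperlogTypeIRate`). [this file] -/
theorem quarterLogPincer_superlogTypeIRateGlue_proof :
    Summit.NavierStokesRegularity.NavierStokesRegularity.Theses.QuarterLogPincer.SuperlogTypeIRateGlue := by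
  unfold Summit.NavierStokesRegularity.NavierStokesRegularity.Theses.QuarterLogPincer.SuperlogTypeIRateGlue
    Summit.NavierStokesRegularity.NavierStokesRegularity.Theses.QuarterLogPincer.QuantBridge
  intro h₁ h₂
  exact h₂ h₁

end Summit.NavierStokesRegularity.NavierStokesRegularity.Theorems

end
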